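import Mathlib
import Summits.NavierStokesRegularity.NavierStokesRegularity.Theorems.EulerZoomLiouvillePowerGaugeEulerLiouvilleDSSPeriodMap
import Summits.NavierStokesRegularity.NavierStokesRegularity.Theorems.EulerZoomLiouvillePowerGaugeEulerLiouvilleDSSNodeSpectralDominated
import Summits.NavierStokesRegularity.NavierStokesRegularity.Theorems.EulerZoomLiouvillePowerGaugeEulerLiouvilleDSSNodeIterateSplitting
import HarnessLib.Audit

/-!
# Crux E `PowerGaugeEulerLiouville` (stmt-NavierStokesRegularity-19832): **VORTICAL PERMANENT NODES OF A DSS MEMBER ARE THIN** — in the window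
# `ρ > 0`, the backward basin (along the phase lattice) of an exactly self-similar particle path carrying vorticity is Lebesgue-null
# (width seat ns-cas-k2 g3, lane «DSS thin vortical nodes», tool B part 2 = the node theorem)

Route `EulerZoomLiouville` (NavierStokesRegularity), crux E; the DSS twin of the autonomous `Kelvin.exists_trappedSet_null_of_curl_ne_zero`
(…SelfSimilarVorticalNodeThin).  Setting (g2's K-A″ conventions, physical variables): `u` classical Euler on `(−∞,0)` with the Cauchy–Lipschitz
hypotheses, `l`-DSS for the class scaling `u(τ,y) = l^{1+ρ}u(Tτ, ly)` (`T = l^{2+ρ}`, `n = 1/(2+ρ)`), `y*` a PERMANENT NODE (`u(t,(−t)ⁿy*) = −n(−t)^{n−1}y*`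
for all `t < 0`: the exactly self-similar path `t ↦ (−t)ⁿy*` is a particle path) that is VORTICAL at the phase `τ₀ < 0` (`ω(τ₀, x*) ≠ 0`, `x* = (−τ₀)ⁿy*`).

* `fderiv_periodMap_node` — the rescaled period map `F(x) = φ(τ₀, Tτ₀, l·x)` is `C¹`, fixes `x*`, and `DF(x*) = l·Dφ(τ₀,Tτ₀,·)(l x*)` has the node's
  vorticity as an eigenvector, `DF(x*)ω* = lT·ω*` (Cauchy's formula + the DSS law `ω(τ,y) = T·ω(Tτ, ly)`), and `det DF(x*) = l³` (incompressibility);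
* **`volume_setOf_tendsto_vorticalNode_eq_zero`** — since `lT = l^{3+ρ} > l³ > 0` for `ρ > 0`, `l > 1`, the cofactor of `lT` in `χ_{DF(x*)}` has constant
  term `l²/T = l^{−ρ} < 1`: `DSSNodes.exists_dominatedSplitting_pow` + `DSSNodes.addHaar_pastHistorySet_eq_zero_of_dominated_pow` make the set of points
  with an `F`-past history converging to `x*` null, and the backward basin of the node along the phase lattice
  `{x : l^{−j}·φ(Tʲτ₀, τ₀, x) → x*}` consists of such points (`F(q_{j+1}) = q_j` for `q_j = l^{−j}φ(Tʲτ₀,τ₀,x)` by DSS conjugation and the group law).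

Reading for the DSS Bernoulli-clocked stratum (…DSSSimilarityNodes/…DepletionMember): a confined resting trajectory clusters on permanent nodes; where it
CONVERGES to a vortical one, its starting point lies in a null set — the node clause (`(−t)⟪∇u ξ,ξ⟫ ≤ κ < 1`) is needed only at NON-vortical nodes once
convergence is known (e.g. isolated nodes).  WHAT THIS IS NOT: not NS regularity, not the crux E — a measure-zero statement about hypothetical DSS blow-up
members; 19832 is OPEN.  [folklore; MajdaBertozziCUP2002 §1.6 (1.51); Robinson1999 Ch. V §5.10.1; ChaeShvydkoy2013 / Chae2010 (DSS setting)]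
-/

noncomputable section

set_option linter.dupNamespace false

open MeasureTheory Set Filter Topology Metric Function
open scoped NNReal ENNReal ContDiff InnerProductSpace RealInnerProductSpace

namespace Summit.NavierStokesRegularity.NavierStokesRegularity.Theorems.PowerGaugeEulerLiouville.DSSNodes

open Literature.Analysis Literature.Analysis.FluidPDE
open Summit.NavierStokesRegularity.NavierStokesRegularity.Theorems.PowerGaugeEulerLiouville.SimilarityBernoulli

variable {u : ℝ → EuclideanSpace ℝ (Fin 3) → EuclideanSpace ℝ (Fin 3)} {p : ℝ → EuclideanSpace ℝ (Fin 3) → ℝ} {ρ l : ℝ}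

/-- `(T·(−τ₀))ⁿ = l·(−τ₀)ⁿ` with `T = l^{2+ρ}`, `n = 1/(2+ρ)`: the node's position one period earlier is `l` times its position. [folklore] -/
theorem node_scale (hl : 0 < l) (hρ : 0 < 2 + ρ) {τ₀ : ℝ} (hτ₀ : τ₀ < 0) (ys : EuclideanSpace ℝ (Fin 3)) :
    l • ((-τ₀) ^ (2 + ρ)⁻¹ • ys) = (-(l ^ (2 + ρ) * τ₀)) ^ (2 + ρ)⁻¹ • ys := by
  rw [smul_smul]
  congr 1
  rw [show -(l ^ (2 + ρ) * τ₀) = l ^ (2 + ρ) * (-τ₀) by ring,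
    Real.mul_rpow (Real.rpow_nonneg hl.le _) (by linarith), ← Real.rpow_mul hl.le, mul_inv_cancel₀ hρ.ne', Real.rpow_one]

/-- **THE PERIOD MAP AT A VORTICAL PERMANENT NODE.**  `F(x) = φ(τ₀, Tτ₀, l·x)` is `C¹`, `F x* = x*`, `DF(x*)ω* = (lT)·ω*` for `ω* = ω(τ₀,x*)`, and
`det DF(x*) = l³`. [cite: MajdaBertozziCUP2002, §1.6 Prop. 1.8 (1.51) and §1.3 Prop. 1.4] -/
theorem fderiv_periodMap_node (hcl : IsClassicalEulerSolutionOn (Iio 0) 0 u p) (hL : ODE.IsUniformlyLipschitzOn u (Iio 0))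
    (hl : 1 < l) (hρ : 0 < 2 + ρ)
    (hdss : ∀ τ : ℝ, τ < 0 → ∀ y, u τ y = (l ^ (1 + ρ)) • u ((l ^ (2 + ρ)) * τ) (l • y))
    {ys : EuclideanSpace ℝ (Fin 3)}
    (hnode : ∀ t : ℝ, t < 0 → u t ((-t) ^ (2 + ρ)⁻¹ • ys) = (-((2 + ρ)⁻¹ * (-t) ^ ((2 + ρ)⁻¹ - 1))) • ys)
    {τ₀ : ℝ} (hτ₀ : τ₀ < 0) :
    ContDiff ℝ 1 (fun x : EuclideanSpace ℝ (Fin 3) => ODE.evolutionMap u (l ^ (2 + ρ) * τ₀) τ₀ (l • x)) ∧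
    (fun x : EuclideanSpace ℝ (Fin 3) => ODE.evolutionMap u (l ^ (2 + ρ) * τ₀) τ₀ (l • x)) ((-τ₀) ^ (2 + ρ)⁻¹ • ys) =
      (-τ₀) ^ (2 + ρ)⁻¹ • ys ∧
    fderiv ℝ (fun x : EuclideanSpace ℝ (Fin 3) => ODE.evolutionMap u (l ^ (2 + ρ) * τ₀) τ₀ (l • x)) ((-τ₀) ^ (2 + ρ)⁻¹ • ys)
        (curl (u τ₀) ((-τ₀) ^ (2 + ρ)⁻¹ • ys)) = (l * l ^ (2 + ρ)) • curl (u τ₀) ((-τ₀) ^ (2 + ρ)⁻¹ • ys) ∧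
    (fderiv ℝ (fun x : EuclideanSpace ℝ (Fin 3) => ODE.evolutionMap u (l ^ (2 + ρ) * τ₀) τ₀ (l • x)) ((-τ₀) ^ (2 + ρ)⁻¹ • ys)).det =
      l ^ 3 := by
  have hl0 : 0 < l := zero_lt_one.trans hl
  set n : ℝ := (2 + ρ)⁻¹ with hn
  set T : ℝ := l ^ (2 + ρ) with hT
  have hT1 : 1 < T := Real.one_lt_rpow hl hρ
  have hT0 : 0 < T := zero_lt_one.trans hT1
  have hTτ₀ : T * τ₀ < 0 := mul_neg_of_pos_of_neg hT0 hτ₀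
  set xs : EuclideanSpace ℝ (Fin 3) := (-τ₀) ^ n • ys with hxs
  set Φ : EuclideanSpace ℝ (Fin 3) → EuclideanSpace ℝ (Fin 3) := ODE.evolutionMap u (T * τ₀) τ₀ with hΦ
  have hlxs : l • xs = (-(T * τ₀)) ^ n • ys := node_scale hl0 hρ hτ₀ ys
  -- fixed point
  have hfix : Φ (l • xs) = xs := by
    rw [hlxs, hΦ, hxs]
    exact evolutionMap_permanentNode hL hnode hTτ₀ hτ₀
  -- smoothness, Cauchy's formula and the Jacobian (these need the body of `Φ`)
  have hΦs : ContDiff ℝ ∞ Φ := contDiff_evolutionMap_any hcl hL hTτ₀ hτ₀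
  have hcauchy : curl (u τ₀) (Φ (l • xs)) = fderiv ℝ Φ (l • xs) (curl (u (T * τ₀)) (l • xs)) :=
    curl_evolutionMap_any hcl hL hTτ₀ hτ₀ (l • xs)
  have hdetΦ : (fderiv ℝ Φ (l • xs)).det = 1 := det_fderiv_evolutionMap_any hcl hL hTτ₀ hτ₀ (l • xs)
  have hcurl1 := curl_dss_iterate hl hρ hdss 1 hτ₀ xs
  simp only [pow_one] at hcurl1
  rw [← hT] at hcurl1
  clear_value xs Φ
  have hΦd : Differentiable ℝ Φ := hΦs.differentiable (by simp)
  have hsm : ContDiff ℝ ∞ (fun x : EuclideanSpace ℝ (Fin 3) => l • x) := contDiff_id.const_smul l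
  have hF : ContDiff ℝ 1 (fun x : EuclideanSpace ℝ (Fin 3) => Φ (l • x)) :=
    (hΦs.of_le (by exact_mod_cast le_top)).comp (hsm.of_le (by exact_mod_cast le_top))
  have hDF : fderiv ℝ (fun x : EuclideanSpace ℝ (Fin 3) => Φ (l • x)) xs =
      (fderiv ℝ Φ (l • xs)).comp (l • ContinuousLinearMap.id ℝ (EuclideanSpace ℝ (Fin 3))) := by
    have h1 : HasFDerivAt Φ (fderiv ℝ Φ (l • xs)) (l • xs) := (hΦd _).hasFDerivAt
    have h2 : HasFDerivAt (fun x : EuclideanSpace ℝ (Fin 3) => l • x)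
        (l • ContinuousLinearMap.id ℝ (EuclideanSpace ℝ (Fin 3))) xs :=
      (l • ContinuousLinearMap.id ℝ (EuclideanSpace ℝ (Fin 3))).hasFDerivAt
    exact (h1.comp xs h2).fderiv
  -- eigenvector: Cauchy's formula + the DSS law of the vorticity
  have hcurlT : curl (u (T * τ₀)) (l • xs) = T⁻¹ • curl (u τ₀) xs := by
    rw [hcurl1, smul_smul, inv_mul_cancel₀ hT0.ne', one_smul]
  rw [hfix, hcurlT, map_smul] at hcauchy
  have hDΦ : fderiv ℝ Φ (l • xs) (curl (u τ₀) xs) = T • curl (u τ₀) xs := by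
    calc fderiv ℝ Φ (l • xs) (curl (u τ₀) xs) = T • (T⁻¹ • fderiv ℝ Φ (l • xs) (curl (u τ₀) xs)) := by
          rw [smul_smul, mul_inv_cancel₀ hT0.ne', one_smul]
      _ = T • curl (u τ₀) xs := by rw [← hcauchy]
  refine ⟨hF, hfix, ?_, ?_⟩
  · rw [hDF, ContinuousLinearMap.comp_apply, smul_apply, ContinuousLinearMap.id_apply, map_smul, hDΦ, smul_smul]
  · rw [hDF, ContinuousLinearMap.det,
      show (((fderiv ℝ Φ (l • xs)).comp (l • ContinuousLinearMap.id ℝ (EuclideanSpace ℝ (Fin 3))) :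
          EuclideanSpace ℝ (Fin 3) →L[ℝ] EuclideanSpace ℝ (Fin 3)) : EuclideanSpace ℝ (Fin 3) →ₗ[ℝ] EuclideanSpace ℝ (Fin 3)) =
        ((fderiv ℝ Φ (l • xs) : EuclideanSpace ℝ (Fin 3) →L[ℝ] EuclideanSpace ℝ (Fin 3)) :
          EuclideanSpace ℝ (Fin 3) →ₗ[ℝ] EuclideanSpace ℝ (Fin 3)).comp
        ((l • ContinuousLinearMap.id ℝ (EuclideanSpace ℝ (Fin 3)) : EuclideanSpace ℝ (Fin 3) →L[ℝ] EuclideanSpace ℝ (Fin 3)) :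
          EuclideanSpace ℝ (Fin 3) →ₗ[ℝ] EuclideanSpace ℝ (Fin 3)) from rfl,
      LinearMap.det_comp]
    have h1 : LinearMap.det ((fderiv ℝ Φ (l • xs) : EuclideanSpace ℝ (Fin 3) →L[ℝ] EuclideanSpace ℝ (Fin 3)) :
        EuclideanSpace ℝ (Fin 3) →ₗ[ℝ] EuclideanSpace ℝ (Fin 3)) = 1 := hdetΦ
    rw [h1, one_mul, ContinuousLinearMap.toLinearMap_smul, ContinuousLinearMap.coe_id, LinearMap.det_smul, LinearMap.det_id,
      finrank_euclideanSpace_fin]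
    simp

/-- **VORTICAL PERMANENT NODES OF A DSS MEMBER ARE THIN (window `ρ > 0`).**  `u` classical Euler on `(−∞,0)` with the Cauchy–Lipschitz hypotheses,
`l`-DSS for the class scaling (`l > 1`, `ρ > 0`, `T = l^{2+ρ}`, `n = 1/(2+ρ)`), `y*` a permanent node (`u(t,(−t)ⁿy*) = −n(−t)^{n−1}y*` for all `t < 0`)
whose vorticity at the phase `τ₀ < 0` does not vanish, `ω(τ₀, (−τ₀)ⁿy*) ≠ 0`.  Then the set of points `x` whose backward trajectory from time `τ₀`
converges to the node along the phase lattice — `l^{−j}·φ(Tʲτ₀, τ₀, x) → (−τ₀)ⁿy*` as `j → ∞`, i.e. the similarity positions at the times `Tʲτ₀` tend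
to `y*` — is Lebesgue-NULL.  (Period map `F(x) = φ(τ₀,Tτ₀,lx)`: `DF(x*)ω* = lT·ω*`, `det DF(x*) = l³ < lT = l^{3+ρ}` ⇒ dominated contracting
splitting of a power ⇒ cone lemma.) [cite: Robinson1999, Ch. V §5.10.1 (cone estimate, dominated form; proved in the tree)] -/
theorem volume_setOf_tendsto_vorticalNode_eq_zero (hcl : IsClassicalEulerSolutionOn (Iio 0) 0 u p)
    (hL : ODE.IsUniformlyLipschitzOn u (Iio 0)) (hl : 1 < l) (hρ : 0 < ρ)
    (hdss : ∀ τ : ℝ, τ < 0 → ∀ y, u τ y = (l ^ (1 + ρ)) • u ((l ^ (2 + ρ)) * τ) (l • y))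
    {ys : EuclideanSpace ℝ (Fin 3)}
    (hnode : ∀ t : ℝ, t < 0 → u t ((-t) ^ (2 + ρ)⁻¹ • ys) = (-((2 + ρ)⁻¹ * (-t) ^ ((2 + ρ)⁻¹ - 1))) • ys)
    {τ₀ : ℝ} (hτ₀ : τ₀ < 0) (hvort : curl (u τ₀) ((-τ₀) ^ (2 + ρ)⁻¹ • ys) ≠ 0) :
    volume {x : EuclideanSpace ℝ (Fin 3) |
      Tendsto (fun j : ℕ => (l ^ j)⁻¹ • ODE.evolutionMap u τ₀ ((l ^ (2 + ρ)) ^ j * τ₀) x) atTop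
        (𝓝 ((-τ₀) ^ (2 + ρ)⁻¹ • ys))} = 0 := by
  have hl0 : 0 < l := zero_lt_one.trans hl
  have hρ2 : 0 < 2 + ρ := by linarith
  set n : ℝ := (2 + ρ)⁻¹ with hn
  set T : ℝ := l ^ (2 + ρ) with hT
  have hT1 : 1 < T := Real.one_lt_rpow hl hρ2
  have hT0 : 0 < T := zero_lt_one.trans hT1
  have hTτ₀ : T * τ₀ < 0 := mul_neg_of_pos_of_neg hT0 hτ₀
  set xs : EuclideanSpace ℝ (Fin 3) := (-τ₀) ^ n • ys with hxs
  obtain ⟨hF, hfix, hMom, hMdet⟩ := fderiv_periodMap_node hcl hL hl hρ2 hdss hnode hτ₀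
  rw [← hT] at hF hfix hMom hMdet
  rw [← hn, ← hxs] at hfix hMom hMdet
  set F : EuclideanSpace ℝ (Fin 3) → EuclideanSpace ℝ (Fin 3) := fun x => ODE.evolutionMap u (T * τ₀) τ₀ (l • x) with hFdef
  -- the two numbers: `λ₀ = lT = l^{3+ρ} > 1` and `0 < det = l³ < λ₀`
  have hlam : 1 < l * T := by nlinarith
  have hdet0 : 0 < (fderiv ℝ F xs).det := by rw [hMdet]; positivity
  have hdet : (fderiv ℝ F xs).det < l * T := by
    rw [hMdet, hT]
    have h3 : l ^ 3 = l * l ^ (2 : ℝ) := by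
      rw [show (2 : ℝ) = ((2 : ℕ) : ℝ) by norm_num, Real.rpow_natCast]; ring
    rw [h3]
    exact mul_lt_mul_of_pos_left (Real.rpow_lt_rpow_of_exponent_lt hl (by linarith)) hl0
  -- dominated splitting of a power, then the cone lemma
  obtain ⟨Es, Ec, k, a, b, hcompl, hs, hc, hEc, hk, ha1, hab, hcon, hdom⟩ :=
    exists_dominatedSplitting_pow (fderiv ℝ F xs) hvort hMom hlam hdet0 hdet
  have hnull := addHaar_pastHistorySet_eq_zero_of_dominated_pow (volume : Measure (EuclideanSpace ℝ (Fin 3)))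
    hF hfix hcompl hs hc hk ha1 hab hcon hdom hEc
  -- the backward basin along the phase lattice consists of points with an `F`-past history converging to `x*`
  refine measure_mono_null (fun x hx => ?_) hnull
  refine ⟨fun j => (l ^ j)⁻¹ • ODE.evolutionMap u τ₀ (T ^ j * τ₀) x, by simp [ODE.evolutionMap_self], fun j => ?_, hx⟩
  -- `F(q_{j+1}) = q_j`: DSS conjugation with factor `lʲ` and the group law
  have hlj : 0 < l ^ j := pow_pos hl0 j
  have hTj : (l ^ j) ^ (2 + ρ) = T ^ j := rpow_natPow_comm hl0.le (2 + ρ) j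
  have hconj := evolutionMap_dss_conj hL hlj (dss_pow hl hρ2 hdss j) hTτ₀ hτ₀
    (ODE.evolutionMap u τ₀ (T ^ (j + 1) * τ₀) x)
  rw [hTj, ← mul_assoc, ← pow_succ] at hconj
  have hTj1 : T ^ (j + 1) * τ₀ < 0 := mul_neg_of_pos_of_neg (pow_pos hT0 _) hτ₀
  have hTj0 : T ^ j * τ₀ < 0 := mul_neg_of_pos_of_neg (pow_pos hT0 _) hτ₀
  have htrans : ODE.evolutionMap u (T ^ (j + 1) * τ₀) (T ^ j * τ₀) (ODE.evolutionMap u τ₀ (T ^ (j + 1) * τ₀) x) =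
      ODE.evolutionMap u τ₀ (T ^ j * τ₀) x :=
    hL.evolutionMap_trans (convex_Iio 0) (mem_Iio.2 hτ₀) (mem_Iio.2 hTj1) (mem_Iio.2 hTj0) x
  rw [htrans] at hconj
  -- `hconj : φ(Tʲτ₀ ← τ₀) x = lʲ · F-type map applied to l^{−j} · φ(T^{j+1}τ₀ ← τ₀) x`
  show ODE.evolutionMap u (T * τ₀) τ₀ (l • ((l ^ (j + 1))⁻¹ • ODE.evolutionMap u τ₀ (T ^ (j + 1) * τ₀) x)) =
    (l ^ j)⁻¹ • ODE.evolutionMap u τ₀ (T ^ j * τ₀) x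
  rw [smul_smul, show l * (l ^ (j + 1))⁻¹ = (l ^ j)⁻¹ by rw [pow_succ]; field_simp, hconj, smul_smul,
    inv_mul_cancel₀ hlj.ne', one_smul]

end Summit.NavierStokesRegularity.NavierStokesRegularity.Theorems.PowerGaugeEulerLiouville.DSSNodes

end
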